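import Summits.AnomalousDissipation.AnomalousDissipation.Theorems.SawtoothPulseCascadeK1LocalisedCascadeExactChirp
import Mathlib.Dynamics.Ergodic.AddCircle

/-!
# K1loc, line `Spectral` / thin start — helper: N-TEETH RESCALING AND THE SIDEBAND ENERGY OF THE EXACT CHIRP (S-D start, «SidebandEnergy»)

Helper file of the prover lane on the crux `K1LocalisedCascade` (stmt-AnomalousDissipation-19491), route
`SawtoothPulseCascade` (glue for the fibre-`L²` START of the ledger, p2 g5 07:35:22Z «SidebandEnergy» (a)+(b)).
`…ExactChirp` bounds the coefficients of the ONE-tooth exact chirp `g₀(t) = exp(−2πiλ·tri(2πt)/(2π))`, `λ ∈ ℤ`: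
`‖ĝ₀(q)‖ ≤ 1/(π|λ+q|) + 1/(π|λ−q|)`.  The phase-`j` chirp has `N_j` teeth, `g(t) = h(N_j·t)` with `h` the one-tooth chirp of
strain `λ/N_j`, and the window lemma in fibre-`L²` form (`…FibreWindowL2`) needs the SIDEBAND energy of `g` beyond distance `D`
from `±λ`.  This file supplies both reductions:
* §1 **`N`-teeth rescaling** (any continuous `h : 𝕋 → ℂ`, `N ≥ 1`, `g = h ∘ (N • ·)`): `fourierCoeff_comp_nsmul_eq_zero`
  (`ĝ(q) = 0` unless `N ∣ q`), `fourierCoeff_comp_nsmul_mul` (`ĝ(Nq′) = ĥ(q′)`, the map `t ↦ N•t` preserves the Haar measure),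
  `sum_sq_norm_fourierCoeff_comp_nsmul_le` (`Σ_{q∈S}‖ĝ(q)‖² ≤ Σ_{q′∈T}‖ĥ(q′)‖²` whenever `q/N ∈ T` for the multiples `q ∈ S`),
  and `nsmul_coe` (`N • (t mod 1) = (N t) mod 1`);
* §2 **sideband energy** (`sum_inv_sq_le_of_le_abs`: `Σ_{j∈J} 1/j² ≤ 2/(D−1)` for a finite `J ⊆ {|j| ≥ D}`, `D ≥ 2`), and
  **`sum_sq_norm_fourierCoeff_exactChirp_sideband_le`**: for every finite `S ⊆ {q : D ≤ |q+λ| ∧ D ≤ |q−λ|}` (`D ≥ 2`),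
  `Σ_{q∈S} ‖ĝ₀(q)‖² ≤ (8/π²)·1/(D−1)` — the `E_n` of `…FibreWindowL2` for a notch of half-width `D`.
No definitions; nothing about the crux. [cite: Grafakos2014, Prop. 3.1.2 (5)] [problem: turb]
-/

-- `Summit.<Summit>.<Problem>`: single-conjunct summit, the duplicate namespace segment is deliberate.
set_option linter.dupNamespace false

noncomputable section

namespace Summit.AnomalousDissipation.AnomalousDissipation.Theorems.SawtoothPulseCascade.K1Start

open MeasureTheory Set Filter Topology UnitAddTorus Function Complex AddCircle
open scoped Real
open Literature.Analysis Literature.Analysis.FunctionSpaces Literature.Analysis.FunctionSpaces.Torus Literature.Analysis.FluidPDE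
open Literature.Analysis.FluidPDE.SawtoothCascade

/-! ## §1 `N`-teeth rescaling `g = h ∘ (N • ·)` -/

/-- `N • (t mod 1) = (N·t) mod 1`. [folklore] -/
theorem nsmul_coe (N : ℕ) (t : ℝ) : N • ((t : ℝ) : UnitAddCircle) = (((N : ℝ) * t : ℝ) : UnitAddCircle) := by
  rw [← AddCircle.coe_nsmul, nsmul_eq_mul]

/-- `g = h ∘ (N • ·)` is `1/N`-periodic. [folklore] -/
theorem comp_nsmul_add_inv (N : ℕ) (hN : 0 < N) (h : UnitAddCircle → ℂ) (b : UnitAddCircle) :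
    h (N • (b + (((N : ℝ)⁻¹ : ℝ) : UnitAddCircle))) = h (N • b) := by
  have hN' : (N : ℝ) ≠ 0 := by exact_mod_cast hN.ne'
  rw [smul_add, ← AddCircle.coe_nsmul, nsmul_eq_mul, mul_inv_cancel₀ hN']
  have h1 : ((1 : ℝ) : UnitAddCircle) = 0 := by
    rw [AddCircle.coe_eq_zero_iff]; exact ⟨1, by simp⟩
  rw [h1, add_zero]

/-- **Rescaled coefficients vanish off the multiples of `N`**: for `h` continuous and `¬ N ∣ q`, `𝓕(h ∘ (N•·))(q) = 0`.
[cite: Grafakos2014, Prop. 3.1.2 (5)] -/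
theorem fourierCoeff_comp_nsmul_eq_zero {N : ℕ} (hN : 0 < N) {h : UnitAddCircle → ℂ} (hh : Continuous h) {q : ℤ}
    (hq : ¬ (N : ℤ) ∣ q) : fourierCoeff (fun t : UnitAddCircle => h (N • t)) q = 0 := by
  have hgc : Continuous fun t : UnitAddCircle => h (N • t) := hh.comp (continuous_nsmul N)
  set G : C(UnitAddCircle, ℂ) := ⟨fun t => h (N • t), hgc⟩ with hG_def
  have hper : ∀ b : UnitAddCircle, G (b + (((N : ℝ)⁻¹ : ℝ) : UnitAddCircle)) = G b := fun b =>
    comp_nsmul_add_inv N hN h b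
  have hc := Literature.Analysis.Fourier.fourierCoeff_comp_add_right G (((N : ℝ)⁻¹ : ℝ) : UnitAddCircle) q
  have hfun : (fun x => G (x + (((N : ℝ)⁻¹ : ℝ) : UnitAddCircle))) = fun t => h (N • t) := funext hper
  rw [hfun, show (G : UnitAddCircle → ℂ) = fun t => h (N • t) from rfl] at hc
  have hne : fourier q (((N : ℝ)⁻¹ : ℝ) : UnitAddCircle) ≠ 1 := fun h1 =>
    hq ((fourier_inv_natCast_eq_one_iff hN q).1 h1)
  have h' : (1 - fourier q (((N : ℝ)⁻¹ : ℝ) : UnitAddCircle)) * fourierCoeff (fun t => h (N • t)) q = 0 := by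
    rw [sub_mul, one_mul, ← hc, sub_self]
  exact (mul_eq_zero.1 h').resolve_left (sub_ne_zero.2 (Ne.symm hne))

/-- **Rescaled coefficients at the multiples of `N`**: `𝓕(h ∘ (N•·))(N q′) = 𝓕h(q′)` (`t ↦ N•t` preserves the Haar measure of `𝕋`).
[cite: Grafakos2014, Prop. 3.1.2 (5)] -/
theorem fourierCoeff_comp_nsmul_mul {N : ℕ} (hN : 0 < N) {h : UnitAddCircle → ℂ} (hh : Continuous h) (q' : ℤ) :
    fourierCoeff (fun t : UnitAddCircle => h (N • t)) ((N : ℤ) * q') = fourierCoeff h q' := by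
  -- the integrand is `(e_{−q′} • h) ∘ (N • ·)`
  have hint : ∀ t : UnitAddCircle, (fourier (-((N : ℤ) * q')) t : ℂ) • h (N • t) =
      (fun s : UnitAddCircle => (fourier (-q') s : ℂ) • h s) (N • t) := by
    intro t
    simp only [fourier_apply]
    congr 2
    rw [show -((N : ℤ) * q') = (-q') * (N : ℤ) by ring, mul_zsmul, natCast_zsmul]
  -- `t ↦ N • t` preserves the Haar (= volume) measure
  have hmp : MeasurePreserving (fun t : UnitAddCircle => N • t) volume volume := by
    rcases Nat.lt_or_ge 1 N with h1 | h1
    · exact (AddCircle.ergodic_nsmul h1).toMeasurePreserving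
    · have hN1 : N = 1 := le_antisymm h1 hN
      subst hN1
      have e : (fun t : UnitAddCircle => (1 : ℕ) • t) = id := funext fun t => one_smul ℕ t
      rw [e]
      exact MeasurePreserving.id volume
  have hF : AEStronglyMeasurable (fun s : UnitAddCircle => (fourier (-q') s : ℂ) • h s) volume :=
    (((fourier (-q')).continuous).smul hh).aestronglyMeasurable
  unfold fourierCoeff
  simp_rw [hint]
  rw [← volume_unitAddCircle_eq_haar]
  calc ∫ x : UnitAddCircle, (fun s : UnitAddCircle => (fourier (-q') s : ℂ) • h s) (N • x)
      = ∫ y, (fun s : UnitAddCircle => (fourier (-q') s : ℂ) • h s) y ∂(Measure.map (fun t : UnitAddCircle => N • t) volume) :=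
        (integral_map hmp.measurable.aemeasurable (by rw [hmp.map_eq]; exact hF)).symm
    _ = ∫ y : UnitAddCircle, (fourier (-q') y : ℂ) • h y := by rw [hmp.map_eq]

/-- **Energy under rescaling**: for finite `S ⊆ ℤ` and `T ⊇ {q/N : q ∈ S, N ∣ q}`,
`Σ_{q∈S} ‖𝓕(h ∘ (N•·))(q)‖² ≤ Σ_{q′∈T} ‖𝓕h(q′)‖²`. [cite: Grafakos2014, Prop. 3.1.2 (5)] -/
theorem sum_sq_norm_fourierCoeff_comp_nsmul_le {N : ℕ} (hN : 0 < N) {h : UnitAddCircle → ℂ} (hh : Continuous h)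
    (S T : Finset ℤ) (hST : ∀ q ∈ S, (N : ℤ) ∣ q → q / N ∈ T) :
    ∑ q ∈ S, ‖fourierCoeff (fun t : UnitAddCircle => h (N • t)) q‖ ^ 2 ≤ ∑ q' ∈ T, ‖fourierCoeff h q'‖ ^ 2 := by
  classical
  have hNz : (N : ℤ) ≠ 0 := by exact_mod_cast hN.ne'
  -- drop the non-multiples, reindex the multiples by `q ↦ q / N`
  set S₁ := S.filter (fun q : ℤ => (N : ℤ) ∣ q) with hS₁
  have h1 : ∑ q ∈ S, ‖fourierCoeff (fun t : UnitAddCircle => h (N • t)) q‖ ^ 2 =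
      ∑ q ∈ S₁, ‖fourierCoeff (fun t : UnitAddCircle => h (N • t)) q‖ ^ 2 := by
    rw [hS₁, Finset.sum_filter]
    refine Finset.sum_congr rfl fun q _ => ?_
    split_ifs with hq
    · rfl
    · rw [fourierCoeff_comp_nsmul_eq_zero hN hh hq]; simp
  have h2 : ∑ q ∈ S₁, ‖fourierCoeff (fun t : UnitAddCircle => h (N • t)) q‖ ^ 2 =
      ∑ q ∈ S₁, ‖fourierCoeff h (q / N)‖ ^ 2 := by
    refine Finset.sum_congr rfl fun q hq => ?_
    rw [hS₁, Finset.mem_filter] at hq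
    obtain ⟨c, hc⟩ := hq.2
    rw [hc, Int.mul_ediv_cancel_left _ hNz, fourierCoeff_comp_nsmul_mul hN hh]
  have hinj : Set.InjOn (fun q : ℤ => q / N) (S₁ : Set ℤ) := by
    intro q hq q₂ hq₂ hqq
    rw [Finset.mem_coe, hS₁, Finset.mem_filter] at hq hq₂
    obtain ⟨c, hc⟩ := hq.2
    obtain ⟨c₂, hc₂⟩ := hq₂.2
    simp only [hc, hc₂, Int.mul_ediv_cancel_left _ hNz] at hqq
    rw [hc, hc₂, hqq]
  rw [h1, h2, ← Finset.sum_image (f := fun q' : ℤ => ‖fourierCoeff h q'‖ ^ 2) hinj]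
  refine Finset.sum_le_sum_of_subset_of_nonneg (fun q' hq' => ?_) fun _ _ _ => sq_nonneg _
  rw [Finset.mem_image] at hq'
  obtain ⟨q, hq, rfl⟩ := hq'
  rw [hS₁, Finset.mem_filter] at hq
  exact hST q hq.1 hq.2

/-! ## §2 The sideband energy of the one-tooth exact chirp -/

/-- **Inverse squares beyond `D`**: for a finite set `J` of integers with `|j| ≥ D ≥ 2`, `Σ_{j∈J} 1/j² ≤ 2/(D−1)`
(`1/j² ≤ 1/(|j|−1) − 1/|j|`, telescoping on each side). [folklore] -/
theorem sum_inv_sq_le_of_le_abs {D : ℕ} (hD : 2 ≤ D) (J : Finset ℤ) (hJ : ∀ j ∈ J, (D : ℤ) ≤ |j|) :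
    ∑ j ∈ J, 1 / ((j : ℝ)) ^ 2 ≤ 2 / ((D : ℝ) - 1) := by
  classical
  -- bound by the sum over the symmetric range `D ≤ |j| ≤ M`
  obtain ⟨M, hM⟩ : ∃ M : ℕ, ∀ j ∈ J, |j| ≤ (M : ℤ) := by
    refine ⟨J.sup fun j => (|j|).toNat, fun j hj => ?_⟩
    have h := Finset.le_sup (f := fun j => (|j|).toNat) hj
    have : (|j|).toNat = |j| := Int.toNat_of_nonneg (abs_nonneg j)
    omega
  have hD1 : (1 : ℝ) ≤ (D : ℝ) - 1 := by
    have : (2 : ℝ) ≤ D := by exact_mod_cast hD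
    linarith
  -- telescoping bound on one side: `Σ_{n=D}^{M} 1/n² ≤ 1/(D-1)`
  have hside : ∀ M : ℕ, ∑ n ∈ Finset.Icc D M, 1 / ((n : ℝ)) ^ 2 ≤ 1 / ((D : ℝ) - 1) := by
    intro M
    have htel : ∀ M : ℕ, ∑ n ∈ Finset.Icc D M, 1 / ((n : ℝ)) ^ 2 ≤ 1 / ((D : ℝ) - 1) - 1 / (max (M : ℝ) ((D : ℝ) - 1)) := by
      intro M
      induction M with
      | zero =>
        rw [Finset.Icc_eq_empty (by omega), Finset.sum_empty]
        have : max ((0 : ℕ) : ℝ) ((D : ℝ) - 1) = (D : ℝ) - 1 := max_eq_right (by push_cast; linarith)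
        rw [this]; linarith
      | succ M ih =>
        by_cases hDM : D ≤ M + 1
        · rw [Finset.sum_Icc_succ_top hDM]
          have hM1 : ((D : ℝ) - 1) ≤ (M : ℝ) := by
            have : (D : ℝ) ≤ (M : ℝ) + 1 := by exact_mod_cast hDM
            linarith
          have hmaxM : max ((M : ℕ) : ℝ) ((D : ℝ) - 1) = (M : ℝ) := max_eq_left hM1
          have hmaxM1 : max (((M + 1 : ℕ)) : ℝ) ((D : ℝ) - 1) = (M : ℝ) + 1 := by
            push_cast; exact max_eq_left (by linarith)
          rw [hmaxM] at ih
          rw [hmaxM1]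
          have hM0 : (0 : ℝ) < M := by linarith
          -- `1/(M+1)² ≤ 1/M − 1/(M+1)`
          have hstep : 1 / (((M + 1 : ℕ) : ℝ)) ^ 2 ≤ 1 / (M : ℝ) - 1 / ((M : ℝ) + 1) := by
            push_cast
            rw [div_sub_div _ _ hM0.ne' (by linarith), div_le_div_iff₀ (by positivity) (by positivity)]
            nlinarith
          linarith
        · push Not at hDM
          rw [Finset.Icc_eq_empty (by omega), Finset.sum_empty]
          have : max (((M + 1 : ℕ)) : ℝ) ((D : ℝ) - 1) = (D : ℝ) - 1 := by
            refine max_eq_right ?_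
            have : (M : ℝ) + 1 + 1 ≤ D := by exact_mod_cast hDM
            push_cast; linarith
          rw [this]; linarith
    have h := htel M
    have : 0 < max (M : ℝ) ((D : ℝ) - 1) := lt_of_lt_of_le (by linarith) (le_max_right _ _)
    have : 0 ≤ 1 / max (M : ℝ) ((D : ℝ) - 1) := by positivity
    linarith
  -- split `J` into its positive and negative parts and inject each into `Icc D M`
  have hpos : ∑ j ∈ J.filter (fun j => 0 ≤ j), 1 / ((j : ℝ)) ^ 2 ≤ 1 / ((D : ℝ) - 1) := by
    have hinj : Set.InjOn (fun j : ℤ => j.toNat) (J.filter (fun j => 0 ≤ j) : Set ℤ) := by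
      intro j hj j' hj' hjj
      simp only [Finset.coe_filter, Set.mem_setOf_eq] at hj hj'
      have := congrArg (fun n : ℕ => (n : ℤ)) hjj
      simp only [Int.toNat_of_nonneg hj.2, Int.toNat_of_nonneg hj'.2] at this
      exact this
    have hsub : (J.filter (fun j => 0 ≤ j)).image (fun j : ℤ => j.toNat) ⊆ Finset.Icc D M := by
      intro n hn
      rw [Finset.mem_image] at hn
      obtain ⟨j, hj, rfl⟩ := hn
      rw [Finset.mem_filter] at hj
      have h1 := hJ j hj.1
      have h2 := hM j hj.1
      rw [abs_of_nonneg hj.2] at h1 h2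
      rw [Finset.mem_Icc]; omega
    have e : ∑ j ∈ J.filter (fun j => 0 ≤ j), 1 / ((j : ℝ)) ^ 2 =
        ∑ n ∈ (J.filter (fun j => 0 ≤ j)).image (fun j : ℤ => j.toNat), 1 / ((n : ℝ)) ^ 2 := by
      rw [Finset.sum_image hinj]
      refine Finset.sum_congr rfl fun j hj => ?_
      rw [Finset.mem_filter] at hj
      have : ((j.toNat : ℕ) : ℝ) = (j : ℝ) := by
        have h := Int.toNat_of_nonneg hj.2
        exact_mod_cast h
      rw [this]
    rw [e]
    exact (Finset.sum_le_sum_of_subset_of_nonneg hsub fun _ _ _ => by positivity).trans (hside M)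
  have hneg : ∑ j ∈ J.filter (fun j => ¬ 0 ≤ j), 1 / ((j : ℝ)) ^ 2 ≤ 1 / ((D : ℝ) - 1) := by
    have hinj : Set.InjOn (fun j : ℤ => (-j).toNat) (J.filter (fun j => ¬ 0 ≤ j) : Set ℤ) := by
      intro j hj j' hj' hjj
      simp only [Finset.coe_filter, Set.mem_setOf_eq, not_le] at hj hj'
      have := congrArg (fun n : ℕ => (n : ℤ)) hjj
      simp only [Int.toNat_of_nonneg (by omega : 0 ≤ -j), Int.toNat_of_nonneg (by omega : 0 ≤ -j')] at this
      omega
    have hsub : (J.filter (fun j => ¬ 0 ≤ j)).image (fun j : ℤ => (-j).toNat) ⊆ Finset.Icc D M := by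
      intro n hn
      rw [Finset.mem_image] at hn
      obtain ⟨j, hj, rfl⟩ := hn
      rw [Finset.mem_filter, not_le] at hj
      have h1 := hJ j hj.1
      have h2 := hM j hj.1
      rw [abs_of_neg hj.2] at h1 h2
      rw [Finset.mem_Icc]; omega
    have e : ∑ j ∈ J.filter (fun j => ¬ 0 ≤ j), 1 / ((j : ℝ)) ^ 2 =
        ∑ n ∈ (J.filter (fun j => ¬ 0 ≤ j)).image (fun j : ℤ => (-j).toNat), 1 / ((n : ℝ)) ^ 2 := by
      rw [Finset.sum_image hinj]
      refine Finset.sum_congr rfl fun j hj => ?_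
      rw [Finset.mem_filter, not_le] at hj
      have : (((-j).toNat : ℕ) : ℝ) = -(j : ℝ) := by
        have h := Int.toNat_of_nonneg (by omega : 0 ≤ -j)
        exact_mod_cast h
      rw [this, neg_sq]
    rw [e]
    exact (Finset.sum_le_sum_of_subset_of_nonneg hsub fun _ _ _ => by positivity).trans (hside M)
  rw [← Finset.sum_filter_add_sum_filter_not J (fun j => 0 ≤ j)]
  have e2 : 2 / ((D : ℝ) - 1) = 1 / ((D : ℝ) - 1) + 1 / ((D : ℝ) - 1) := by ring
  rw [e2]
  exact add_le_add hpos hneg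

/-- **SIDEBAND ENERGY OF THE EXACT CHIRP**: for `λ ∈ ℤ`, `D ≥ 2` and every finite `S ⊆ {q : D ≤ |q+λ| ∧ D ≤ |q−λ|}`,
`Σ_{q∈S} ‖ĝ₀(q)‖² ≤ (8/π²)·1/(D−1)` (`‖ĝ₀(q)‖ ≤ 1/(π|λ+q|) + 1/(π|λ−q|)`, `(x+y)² ≤ 2x²+2y²`, `Σ_{|j|≥D} 1/j² ≤ 2/(D−1)` twice).
[cite: Grafakos2014, Prop. 3.1.2 (5)] -/
theorem sum_sq_norm_fourierCoeff_exactChirp_sideband_le {lam : ℤ} {g₀ : UnitAddCircle → ℂ}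
    (hg₀ : ∀ t : ℝ, g₀ (t : UnitAddCircle) = Complex.exp (-(2 * π * I * lam * ((tri (2 * π * t) / (2 * π) : ℝ) : ℂ))))
    (hg₀c : Continuous g₀) {D : ℕ} (hD : 2 ≤ D) (S : Finset ℤ)
    (hS : ∀ q ∈ S, (D : ℤ) ≤ |q + lam| ∧ (D : ℤ) ≤ |q - lam|) :
    ∑ q ∈ S, ‖fourierCoeff g₀ q‖ ^ 2 ≤ 8 / π ^ 2 * (1 / ((D : ℝ) - 1)) := by
  classical
  have hπ : 0 < π := Real.pi_pos
  -- termwise: `‖ĝ₀(q)‖² ≤ (2/π²)(1/(λ+q)² + 1/(λ−q)²)`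
  have hterm : ∀ q ∈ S, ‖fourierCoeff g₀ q‖ ^ 2 ≤
      2 / π ^ 2 * (1 / (((lam + q : ℤ) : ℝ)) ^ 2 + 1 / (((lam - q : ℤ) : ℝ)) ^ 2) := by
    intro q hq
    have h := hS q hq
    have hq1 : q ≠ -lam := by intro e; rw [e, neg_add_cancel, abs_zero] at h; have := h.1; omega
    have hq2 : q ≠ lam := by intro e; rw [e, sub_self, abs_zero] at h; have := h.2; omega
    have hb := norm_fourierCoeff_exactChirp_le hg₀ hg₀c hq1 hq2
    have h0 : 0 ≤ ‖fourierCoeff g₀ q‖ := norm_nonneg _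
    have hx : 0 < |((lam + q : ℤ) : ℝ)| := by
      rw [abs_pos]; exact_mod_cast (show lam + q ≠ 0 by omega)
    have hy : 0 < |((lam - q : ℤ) : ℝ)| := by
      rw [abs_pos]; exact_mod_cast (show lam - q ≠ 0 by omega)
    calc ‖fourierCoeff g₀ q‖ ^ 2 ≤ (1 / (π * |((lam + q : ℤ) : ℝ)|) + 1 / (π * |((lam - q : ℤ) : ℝ)|)) ^ 2 :=
          pow_le_pow_left₀ h0 hb 2
      _ ≤ 2 * (1 / (π * |((lam + q : ℤ) : ℝ)|)) ^ 2 + 2 * (1 / (π * |((lam - q : ℤ) : ℝ)|)) ^ 2 := by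
          nlinarith [sq_nonneg (1 / (π * |((lam + q : ℤ) : ℝ)|) - 1 / (π * |((lam - q : ℤ) : ℝ)|))]
      _ = 2 / π ^ 2 * (1 / (((lam + q : ℤ) : ℝ)) ^ 2 + 1 / (((lam - q : ℤ) : ℝ)) ^ 2) := by
          rw [div_pow, div_pow, mul_pow, mul_pow, sq_abs, sq_abs]
          field_simp
  refine (Finset.sum_le_sum hterm).trans ?_
  rw [← Finset.mul_sum, Finset.sum_add_distrib]
  -- the two inverse-square sums, reindexed by `q ↦ λ + q`, `q ↦ λ − q`
  have hA : ∑ q ∈ S, 1 / (((lam + q : ℤ) : ℝ)) ^ 2 ≤ 2 / ((D : ℝ) - 1) := by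
    have hinj : Set.InjOn (fun q : ℤ => lam + q) (S : Set ℤ) := fun q _ q' _ h => by simpa using h
    rw [← Finset.sum_image (f := fun j : ℤ => 1 / ((j : ℝ)) ^ 2) hinj]
    refine sum_inv_sq_le_of_le_abs hD _ fun j hj => ?_
    rw [Finset.mem_image] at hj
    obtain ⟨q, hq, rfl⟩ := hj
    rw [add_comm]; exact (hS q hq).1
  have hB : ∑ q ∈ S, 1 / (((lam - q : ℤ) : ℝ)) ^ 2 ≤ 2 / ((D : ℝ) - 1) := by
    have hinj : Set.InjOn (fun q : ℤ => lam - q) (S : Set ℤ) := fun q _ q' _ h => by simpa using h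
    rw [← Finset.sum_image (f := fun j : ℤ => 1 / ((j : ℝ)) ^ 2) hinj]
    refine sum_inv_sq_le_of_le_abs hD _ fun j hj => ?_
    rw [Finset.mem_image] at hj
    obtain ⟨q, hq, rfl⟩ := hj
    rw [← abs_neg, neg_sub]; exact (hS q hq).2
  have hπ2 : 0 < 2 / π ^ 2 := by positivity
  calc 2 / π ^ 2 * (∑ q ∈ S, 1 / (((lam + q : ℤ) : ℝ)) ^ 2 + ∑ q ∈ S, 1 / (((lam - q : ℤ) : ℝ)) ^ 2)
      ≤ 2 / π ^ 2 * (2 / ((D : ℝ) - 1) + 2 / ((D : ℝ) - 1)) := mul_le_mul_of_nonneg_left (add_le_add hA hB) hπ2.le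
    _ = 8 / π ^ 2 * (1 / ((D : ℝ) - 1)) := by ring

end Summit.AnomalousDissipation.AnomalousDissipation.Theorems.SawtoothPulseCascade.K1Start
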